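import Mathlib
import HarnessLib
import Literature.MathematicalPhysics.StatisticalMechanics.RenormalisationMapSmallnessTerms

/-!
# Smallness of the Lipschitz constants of the reblocked terms — the top term `Y = X`
# ([ABKM19] Lemma 9.6 / Lemma 10.2, proof, first order)

Companion of RenormalisationMapSmallnessTerms for the LARGE CONNECTED preimages (the second remainder
sum of `GradientRG.nextKStep_sub_opC_eq`, `X ∈ largePartIndex`, `X₁ = ∅`): there the reblocked term
`(e^{−H̃})^{U∖X}(e^{H̃})^{X∖U} R[P₂(e^{−H},K)(X)]` contains the FIRST-ORDER piece `Y = X` (`R K(X)`, the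
large part of the linearisation `C_k`), of degree one.  The adapter below keeps every `Y ≠ X` term in the
shape of the master triple bound (`TorusPolymer.sum_reblock_triples_le`) and pays the top term by
`A^{−|X|_k}` alone (the shape of `TorusPolymer.sum_reblock_large_le`: for a connected non-block `X`,
`A^{−|X|_k} ≤ A^{−η|π(X)|_{k+1}}`), with the Lipschitz differences `2Δ` (prefactor) and `C_Δ` (activity)
and NO small factor `ω` — this is the `largePartEps` mechanism of [ABKM19] Lemma 10.2.

* **`reblockTerm_lipschitzConsts_le_top`** — the displayed bound.

Everything is proved; pure real arithmetic and polymer bookkeeping.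

## References
* S. Adams, S. Buchholz, R. Kotecký, S. Müller, arXiv:1910.13564, proof of Lemma 9.6 ((9.36)–(9.39)) and
  of Lemma 10.2 [AdamsBuchholzKoteckyMuller2019].
-/

noncomputable section

namespace Literature.MathematicalPhysics.StatisticalMechanics.TorusPolymer

open scoped BigOperators Classical
open Finset
open Literature.Barriers.CriticalPhenomena.LongRangePhi4.Polymer (IsConn components)

variable {d M : ℕ} [NeZero M]

omit [NeZero M] in
/-- `n ≤ 2^n` in `ℝ` (counting factors). [folklore] -/
private theorem nat_le_two_pow' (n : ℕ) : (n : ℝ) ≤ 2 ^ n := by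
  induction n with
  | zero => norm_num
  | succ n ih =>
    have : (1 : ℝ) ≤ 2 ^ n := one_le_pow₀ (by norm_num)
    push_cast
    calc (n : ℝ) + 1 ≤ 2 ^ n + 2 ^ n := by linarith
      _ = 2 ^ (n + 1) := by ring
set_option maxHeartbeats 400000 in
/-- **Smallness of the Lipschitz constants of the reblocked terms, top term allowed** (`X₁ = ∅`, `X` with
at least two blocks: the term `Y = X` has degree one and is paid by `A^{−|X|_k}` alone).  With the letters
of RenormalisationMapSmallnessTerms: if `θ + Δ ≤ ω`, `b ≤ ω`, `b' + Δ_H ≤ ω`, `C + C_Δ ≤ ω`, `ω A² ≤ 1`, `A ≥ 1`, `κ ≥ 1 + a + Δ`,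
`X₁ = ∅` and `|X|_k ≥ 2`, then the per-`(X,∅)` constant of `tayNormLE_subsum_reblockTerm_sub_abkm` is at most
`Σ_{Y∈𝓟_k(X∖X₁), Y≠X} (2κ max(1,A_𝒫))^{|X|_k} (κ^{|U|_k}(3Δ+Δ_H+C_Δ) ω A⁴) A^{−(2|X∖Y|_k+|Y|_k+|𝓒(Y)|)}`
`+ (2κ max(1,A_𝒫))^{|X|_k} κ^{|U|_k}(2Δ+C_Δ) A^{−|X|_k}`.
[cite: AdamsBuchholzKoteckyMuller2019, proof of Lemma 9.6 ((9.36)–(9.39), first order)] -/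
theorem reblockTerm_lipschitzConsts_le_top (hMo : Odd M) {s : ℕ} (hs : Odd s)
    {A a Δ θ b b' ΔH C CΔ A𝒫 ω κ : ℝ} (hA : 1 ≤ A) (ha : 0 ≤ a) (hΔ : 0 ≤ Δ) (hθ : 0 ≤ θ)
    (hb : 0 ≤ b) (hb' : 0 ≤ b') (hΔH : 0 ≤ ΔH) (hC : 0 ≤ C) (hCΔ : 0 ≤ CΔ) (hA𝒫 : 0 ≤ A𝒫)
    (hθω : θ + Δ ≤ ω) (hbω : b ≤ ω) (hb'ω : b' + ΔH ≤ ω) (hCω : C + CΔ ≤ ω) (hωA : ω * A ^ 2 ≤ 1)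
    (hκ : 1 + a + Δ ≤ κ) {aF : Finset (Fin d → ZMod M) → ℝ} (haF : ∀ Z, aF Z = (A ^ (blocks s Z).card)⁻¹)
    {U X X₁ : Finset (Fin d → ZMod M)} (hX : IsPolymer s X) (hX₁0 : X₁ = ∅) (h2X : 2 ≤ (blocks s X).card) :
    ((∏ _B ∈ blocks s (U \ X), (a + Δ)) - ∏ _B ∈ blocks s (U \ X), a) * (∏ _B ∈ blocks s (X \ U), a) *
        ((∏ _B ∈ blocks s X₁, θ) *
          ((∑ Y ∈ polys s (X \ X₁), (∏ _B ∈ blocks s ((X \ X₁) \ Y), b) * ∏ Z ∈ components Y, C * aF Z) *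
            A𝒫 ^ numBlocks s (X \ X₁))) +
      (∏ _B ∈ blocks s (U \ X), a) * ((∏ _B ∈ blocks s (X \ U), (a + Δ)) - ∏ _B ∈ blocks s (X \ U), a) *
        ((∏ _B ∈ blocks s X₁, θ) *
          ((∑ Y ∈ polys s (X \ X₁), (∏ _B ∈ blocks s ((X \ X₁) \ Y), b) * ∏ Z ∈ components Y, C * aF Z) *
            A𝒫 ^ numBlocks s (X \ X₁))) +
      (∏ _B ∈ blocks s (U \ X), a) * (∏ _B ∈ blocks s (X \ U), a) *
        (((∏ _B ∈ blocks s X₁, (θ + Δ)) - ∏ _B ∈ blocks s X₁, θ) *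
          ((∑ Y ∈ polys s (X \ X₁), (∏ _B ∈ blocks s ((X \ X₁) \ Y), b) * ∏ Z ∈ components Y, C * aF Z) *
            A𝒫 ^ numBlocks s (X \ X₁))) +
      (∏ _B ∈ blocks s (U \ X), a) * (∏ _B ∈ blocks s (X \ U), a) *
        ((∏ _B ∈ blocks s X₁, θ) *
          ((∑ Y ∈ polys s (X \ X₁),
            (((∏ _B ∈ blocks s ((X \ X₁) \ Y), (b' + ΔH)) - ∏ _B ∈ blocks s ((X \ X₁) \ Y), b') *
              ∏ Z ∈ components Y, C * aF Z +
            (∏ _B ∈ blocks s ((X \ X₁) \ Y), b') *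
              ((∏ Z ∈ components Y, (C * aF Z + CΔ * aF Z)) - ∏ Z ∈ components Y, C * aF Z))) *
            A𝒫 ^ numBlocks s (X \ X₁))) ≤
      (∑ Y ∈ (polys s (X \ X₁)).erase X, (2 * κ * max 1 A𝒫) ^ (blocks s X).card *
        (κ ^ (blocks s U).card * ((3 * Δ + ΔH + CΔ) * (ω * A ^ 4))) *
        (A ^ (2 * (blocks s (X \ Y)).card + (blocks s Y).card + (components Y).card))⁻¹) +
      (2 * κ * max 1 A𝒫) ^ (blocks s X).card * (κ ^ (blocks s U).card * (2 * Δ + CΔ)) *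
        (A ^ (blocks s X).card)⁻¹ := by
  -- names and elementary facts
  have hA0 : 0 < A := by linarith
  have hω0 : 0 ≤ ω := hb.trans hbω
  have hω1 : ω ≤ 1 := by
    have h1 : (1 : ℝ) ≤ A ^ 2 := one_le_pow₀ hA
    nlinarith
  have hκ1 : 1 ≤ κ := by linarith
  have hκ0 : 0 ≤ κ := by linarith
  have haκ : a ≤ κ := by linarith
  have hX₁ : X₁ ∈ polys s X := by rw [hX₁0]; exact empty_mem_polys _ _
  obtain ⟨hX₁X, hX₁p⟩ := mem_polys.1 hX₁
  have hθ1 : θ ≤ 1 := by linarith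
  have hC1 : C ≤ 1 := by linarith
  have hX₂p : IsPolymer s (X \ X₁) := hX.sdiff hX₁p
  set NX := (blocks s X).card with hNXdef
  set cU := (blocks s U).card with hcUdef
  set n₁ := (blocks s X₁).card with hn₁def
  have hNX : NX = n₁ + (blocks s (X \ X₁)).card := card_blocks_eq_add_sdiff hX hX₁
  have hm₂ : (blocks s (X \ U)).card ≤ NX := card_le_card (blocks_mono s sdiff_subset)
  have hm₁ : (blocks s (U \ X)).card ≤ cU := card_le_card (blocks_mono s sdiff_subset)
  have hnb : numBlocks s (X \ X₁) ≤ NX := by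
    rw [← card_blocks_eq_numBlocks]; exact card_le_card (blocks_mono s sdiff_subset)
  have h2NX : (NX : ℝ) ≤ 2 ^ NX := nat_le_two_pow' NX
  set A𝒫' := max 1 A𝒫 with hA𝒫'def
  have hA𝒫'1 : 1 ≤ A𝒫' := le_max_left _ _
  have hP𝒫 : A𝒫 ^ numBlocks s (X \ X₁) ≤ A𝒫' ^ NX :=
    (pow_le_pow_left₀ hA𝒫 (le_max_right 1 A𝒫) _).trans (pow_le_pow_right₀ hA𝒫'1 hnb)
  -- the smallness target of one `Y`
  set S : Finset (Fin d → ZMod M) → ℝ := fun Y =>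
    ω * A ^ 4 * (A ^ (2 * (blocks s (X \ Y)).card + (blocks s Y).card + (components Y).card))⁻¹ with hSdef
  have hS0 : ∀ Y, 0 ≤ S Y := fun Y => by rw [hSdef]; positivity
  -- per-`Y` bookkeeping
  have hYfacts : ∀ Y ∈ polys s (X \ X₁), IsPolymer s Y ∧
      (blocks s (X \ Y)).card = n₁ + (blocks s ((X \ X₁) \ Y)).card ∧
      (blocks s ((X \ X₁) \ Y)).card ≤ NX ∧ (components Y).card ≤ NX := by
    intro Y hY
    obtain ⟨hYX₂, hYp⟩ := mem_polys.1 hY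
    have h1 := card_blocks_eq_add_sdiff hX₂p hY
    have hYX : Y ∈ polys s X := mem_polys.2 ⟨hYX₂.trans sdiff_subset, hYp⟩
    have h2 := card_blocks_eq_add_sdiff hX hYX
    have h3 := card_components_le_card_blocks hMo hs hYp
    refine ⟨hYp, by omega, by omega, by omega⟩
  have hdeg : ∀ Y ∈ (polys s (X \ X₁)).erase X, 2 ≤ (blocks s (X \ Y)).card + (components Y).card := by
    intro Y hY
    obtain ⟨hYX, hY'⟩ := mem_erase.1 hY
    obtain ⟨hYsub, hYp⟩ := mem_polys.1 hY'
    exact two_le_degree_of_ne_self hX h2X (mem_polys.2 ⟨hYsub.trans sdiff_subset, hYp⟩) hYX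
  have hXmem : X ∈ polys s (X \ X₁) := by rw [hX₁0, sdiff_empty]; exact self_mem_polys hX
  have hn₁0 : n₁ = 0 := by rw [hn₁def, hX₁0, TorusPolymer.blocks_empty, card_empty]
  have hXX : (X \ X₁) \ X = ∅ := Finset.sdiff_eq_empty_iff_subset.2 sdiff_subset
  have hmX : (components X).card ≤ NX := card_components_le_card_blocks hMo hs hX
  -- (wrappers for `Y ≠ X`)
  -- the key: `D − 1` small factors and `A^{−|Y|_k}` give `S Y`
  have key : ∀ Y ∈ (polys s (X \ X₁)).erase X, ∀ (x₁ x₂ x₃ : ℝ) (p q r : ℕ), 0 ≤ x₁ → x₁ ≤ ω → 0 ≤ x₂ → x₂ ≤ ω →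
      0 ≤ x₃ → x₃ ≤ ω → n₁ + (blocks s ((X \ X₁) \ Y)).card + (components Y).card ≤ p + q + r + 1 →
      x₁ ^ p * x₂ ^ q * x₃ ^ r * (A ^ (blocks s Y).card)⁻¹ ≤ S Y := by
    intro Y hY x₁ x₂ x₃ p q r h1 h1' h2 h2' h3 h3' hpqr
    obtain ⟨-, hXY, -, -⟩ := hYfacts Y (mem_of_mem_erase hY)
    have hD := hdeg Y hY
    obtain ⟨e, he⟩ : ∃ e, (blocks s (X \ Y)).card + (components Y).card = e + 2 :=
      ⟨(blocks s (X \ Y)).card + (components Y).card - 2, by omega⟩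
    have hpow : x₁ ^ p * x₂ ^ q * x₃ ^ r ≤ ω ^ (e + 1) := by
      calc x₁ ^ p * x₂ ^ q * x₃ ^ r ≤ ω ^ p * ω ^ q * ω ^ r := by
            have := pow_le_pow_left₀ h1 h1' p
            have := pow_le_pow_left₀ h2 h2' q
            have := pow_le_pow_left₀ h3 h3' r
            gcongr
        _ = ω ^ (p + q + r) := by rw [← pow_add, ← pow_add]
        _ ≤ ω ^ (e + 1) := pow_le_pow_of_le_one hω0 hω1 (by omega)
    calc x₁ ^ p * x₂ ^ q * x₃ ^ r * (A ^ (blocks s Y).card)⁻¹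
        ≤ ω ^ (e + 1) * (A ^ (blocks s Y).card)⁻¹ := mul_le_mul_of_nonneg_right hpow (by positivity)
      _ ≤ S Y := smallness_lipschitz hA hω0 hωA he _
  -- the component products
  have hPiC : ∀ Y ∈ polys s (X \ X₁), ∀ x : ℝ, ∏ Z ∈ components Y, x * aF Z =
      x ^ (components Y).card * (A ^ (blocks s Y).card)⁻¹ := fun Y hY x =>
    prod_components_mul_aFactor hMo hs haF (hYfacts Y hY).1 x
  have hPiC' : ∀ Y ∈ polys s (X \ X₁), ∏ Z ∈ components Y, (C * aF Z + CΔ * aF Z) =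
      (C + CΔ) ^ (components Y).card * (A ^ (blocks s Y).card)⁻¹ := by
    intro Y hY
    rw [← hPiC Y hY (C + CΔ)]
    exact prod_congr rfl fun Z _ => by ring
  -- (Y1) the zeroth-order summand: `θ^{n₁} b^{n₂} C^m A^{−|Y|} ≤ S Y`
  have hY1 : ∀ Y ∈ (polys s (X \ X₁)).erase X,
      θ ^ n₁ * ((∏ _B ∈ blocks s ((X \ X₁) \ Y), b) * ∏ Z ∈ components Y, C * aF Z) ≤ S Y := by
    intro Y hY
    rw [hPiC Y (mem_of_mem_erase hY) C, prod_const]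
    calc θ ^ n₁ * (b ^ (blocks s ((X \ X₁) \ Y)).card * (C ^ (components Y).card * (A ^ (blocks s Y).card)⁻¹))
        = θ ^ n₁ * b ^ (blocks s ((X \ X₁) \ Y)).card * C ^ (components Y).card * (A ^ (blocks s Y).card)⁻¹ := by
          ring
      _ ≤ S Y := key Y hY θ b C n₁ (blocks s ((X \ X₁) \ Y)).card (components Y).card hθ (by linarith)
          hb hbω hC (by linarith) (by omega)
  -- (Y3) the `X₁`-slot Lipschitz summand
  have hY3 : ∀ Y ∈ (polys s (X \ X₁)).erase X,
      (Δ * n₁ * (θ + Δ) ^ (n₁ - 1)) * ((∏ _B ∈ blocks s ((X \ X₁) \ Y), b) * ∏ Z ∈ components Y, C * aF Z) ≤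
        Δ * 2 ^ NX * S Y := by
    intro Y hY
    rw [hPiC Y (mem_of_mem_erase hY) C, prod_const]
    have hk := key Y hY (θ + Δ) b C (n₁ - 1) (blocks s ((X \ X₁) \ Y)).card (components Y).card
      (by positivity) hθω hb hbω hC (by linarith) (by omega)
    have hn₁ : (n₁ : ℝ) ≤ 2 ^ NX := le_trans (by exact_mod_cast (by omega : n₁ ≤ NX)) h2NX
    calc Δ * n₁ * (θ + Δ) ^ (n₁ - 1) *
          (b ^ (blocks s ((X \ X₁) \ Y)).card * (C ^ (components Y).card * (A ^ (blocks s Y).card)⁻¹))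
        = Δ * n₁ * ((θ + Δ) ^ (n₁ - 1) * b ^ (blocks s ((X \ X₁) \ Y)).card * C ^ (components Y).card *
            (A ^ (blocks s Y).card)⁻¹) := by ring
      _ ≤ Δ * 2 ^ NX * S Y := by gcongr
  -- (Y4a) the `e^{−H} − 1`-slot Lipschitz summand
  have hY4a : ∀ Y ∈ (polys s (X \ X₁)).erase X,
      θ ^ n₁ * (((∏ _B ∈ blocks s ((X \ X₁) \ Y), (b' + ΔH)) - ∏ _B ∈ blocks s ((X \ X₁) \ Y), b') *
        ∏ Z ∈ components Y, C * aF Z) ≤ ΔH * 2 ^ NX * S Y := by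
    intro Y hY
    obtain ⟨-, -, hn₂, -⟩ := hYfacts Y (mem_of_mem_erase hY)
    have hdiff := prod_const_add_sub_prod_const_le (blocks s ((X \ X₁) \ Y)) hb' hΔH
    rw [hPiC Y (mem_of_mem_erase hY) C]
    have hk := key Y hY θ (b' + ΔH) C n₁ ((blocks s ((X \ X₁) \ Y)).card - 1) (components Y).card hθ
      (by linarith) (by positivity) hb'ω hC (by linarith) (by omega)
    have hn₂' : ((blocks s ((X \ X₁) \ Y)).card : ℝ) ≤ 2 ^ NX := le_trans (by exact_mod_cast hn₂) h2NX
    have hCpos : 0 ≤ C ^ (components Y).card * (A ^ (blocks s Y).card)⁻¹ := by positivity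
    calc θ ^ n₁ * (((∏ _B ∈ blocks s ((X \ X₁) \ Y), (b' + ΔH)) - ∏ _B ∈ blocks s ((X \ X₁) \ Y), b') *
          (C ^ (components Y).card * (A ^ (blocks s Y).card)⁻¹))
        ≤ θ ^ n₁ * ((ΔH * (blocks s ((X \ X₁) \ Y)).card * (b' + ΔH) ^ ((blocks s ((X \ X₁) \ Y)).card - 1)) *
          (C ^ (components Y).card * (A ^ (blocks s Y).card)⁻¹)) := by
          refine mul_le_mul_of_nonneg_left (mul_le_mul_of_nonneg_right hdiff hCpos) (by positivity)
      _ = ΔH * (blocks s ((X \ X₁) \ Y)).card * (θ ^ n₁ * (b' + ΔH) ^ ((blocks s ((X \ X₁) \ Y)).card - 1) *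
          C ^ (components Y).card * (A ^ (blocks s Y).card)⁻¹) := by ring
      _ ≤ ΔH * 2 ^ NX * S Y := by gcongr
  -- (Y4b) the `K`-slot Lipschitz summand
  have hY4b : ∀ Y ∈ (polys s (X \ X₁)).erase X,
      θ ^ n₁ * ((∏ _B ∈ blocks s ((X \ X₁) \ Y), b') *
        ((∏ Z ∈ components Y, (C * aF Z + CΔ * aF Z)) - ∏ Z ∈ components Y, C * aF Z)) ≤
        CΔ * 2 ^ NX * S Y := by
    intro Y hY
    obtain ⟨hYp, -, -, hmN⟩ := hYfacts Y (mem_of_mem_erase hY)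
    rw [hPiC' Y (mem_of_mem_erase hY), hPiC Y (mem_of_mem_erase hY) C, prod_const, ← sub_mul]
    set m := (components Y).card with hm
    have hdiff : (C + CΔ) ^ m - C ^ m ≤ CΔ * m * (C + CΔ) ^ (m - 1) := by
      have := prod_const_add_sub_prod_const_le (components Y) hC hCΔ
      rwa [prod_const, prod_const] at this
    have hk := key Y hY θ b' (C + CΔ) n₁ (blocks s ((X \ X₁) \ Y)).card (m - 1) hθ (by linarith)
      hb' (by linarith) (by positivity) hCω (by omega)
    have hm' : (m : ℝ) ≤ 2 ^ NX := le_trans (by exact_mod_cast hmN) h2NX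
    calc θ ^ n₁ * (b' ^ (blocks s ((X \ X₁) \ Y)).card * (((C + CΔ) ^ m - C ^ m) * (A ^ (blocks s Y).card)⁻¹))
        ≤ θ ^ n₁ * (b' ^ (blocks s ((X \ X₁) \ Y)).card * ((CΔ * m * (C + CΔ) ^ (m - 1)) *
            (A ^ (blocks s Y).card)⁻¹)) := by
          refine mul_le_mul_of_nonneg_left (mul_le_mul_of_nonneg_left
            (mul_le_mul_of_nonneg_right hdiff (by positivity)) (by positivity)) (by positivity)
      _ = CΔ * m * (θ ^ n₁ * b' ^ (blocks s ((X \ X₁) \ Y)).card * (C + CΔ) ^ (m - 1) *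
            (A ^ (blocks s Y).card)⁻¹) := by ring
      _ ≤ CΔ * 2 ^ NX * S Y := by gcongr
  -- the outer constants
  have hdiff₁ : (∏ _B ∈ blocks s (U \ X), (a + Δ)) - ∏ _B ∈ blocks s (U \ X), a ≤ Δ * κ ^ cU := by
    refine (prod_const_add_sub_prod_const_le' _ ha hΔ).trans ?_
    refine mul_le_mul_of_nonneg_left ?_ hΔ
    exact (pow_le_pow_left₀ (by positivity) hκ _).trans (pow_le_pow_right₀ hκ1 hm₁)
  have hdiff₂ : (∏ _B ∈ blocks s (X \ U), (a + Δ)) - ∏ _B ∈ blocks s (X \ U), a ≤ Δ * κ ^ NX := by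
    refine (prod_const_add_sub_prod_const_le' _ ha hΔ).trans ?_
    refine mul_le_mul_of_nonneg_left ?_ hΔ
    exact (pow_le_pow_left₀ (by positivity) hκ _).trans (pow_le_pow_right₀ hκ1 hm₂)
  have hdiff₁0 : 0 ≤ (∏ _B ∈ blocks s (U \ X), (a + Δ)) - ∏ _B ∈ blocks s (U \ X), a := by
    rw [prod_const, prod_const]; exact sub_nonneg.2 (pow_le_pow_left₀ ha (by linarith) _)
  have hdiff₂0 : 0 ≤ (∏ _B ∈ blocks s (X \ U), (a + Δ)) - ∏ _B ∈ blocks s (X \ U), a := by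
    rw [prod_const, prod_const]; exact sub_nonneg.2 (pow_le_pow_left₀ ha (by linarith) _)
  have ha₁ : ∏ _B ∈ blocks s (U \ X), a ≤ κ ^ cU := by
    rw [prod_const]; exact (pow_le_pow_left₀ ha haκ _).trans (pow_le_pow_right₀ hκ1 hm₁)
  have ha₂ : ∏ _B ∈ blocks s (X \ U), a ≤ κ ^ NX := by
    rw [prod_const]; exact (pow_le_pow_left₀ ha haκ _).trans (pow_le_pow_right₀ hκ1 hm₂)
  have ha₁0 : 0 ≤ ∏ _B ∈ blocks s (U \ X), a := prod_nonneg fun _ _ => ha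
  have ha₂0 : 0 ≤ ∏ _B ∈ blocks s (X \ U), a := prod_nonneg fun _ _ => ha
  have hθprod : ∏ _B ∈ blocks s X₁, θ = θ ^ n₁ := prod_const θ
  have hdiff₃ : (∏ _B ∈ blocks s X₁, (θ + Δ)) - ∏ _B ∈ blocks s X₁, θ ≤ Δ * n₁ * (θ + Δ) ^ (n₁ - 1) :=
    prod_const_add_sub_prod_const_le _ hθ hΔ
  have hdiff₃0 : 0 ≤ (∏ _B ∈ blocks s X₁, (θ + Δ)) - ∏ _B ∈ blocks s X₁, θ := by
    rw [prod_const, prod_const]; exact sub_nonneg.2 (pow_le_pow_left₀ hθ (by linarith) _)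
  -- the inner sums against `Σ S`
  set SS := ∑ Y ∈ (polys s (X \ X₁)).erase X, S Y with hSSdef
  have hSS0 : 0 ≤ SS := sum_nonneg fun Y _ => hS0 Y
  set g₀ := ∑ Y ∈ polys s (X \ X₁), (∏ _B ∈ blocks s ((X \ X₁) \ Y), b) * ∏ Z ∈ components Y, C * aF Z
    with hg₀def
  have hg₀0 : 0 ≤ g₀ := sum_nonneg fun Y hY => by
    rw [hPiC Y hY C]; exact mul_nonneg (prod_nonneg fun _ _ => hb) (by positivity)
  have hPiCX : ∀ x : ℝ, ∏ Z ∈ components X, x * aF Z = x ^ (components X).card * (A ^ NX)⁻¹ :=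
    fun x => prod_components_mul_aFactor hMo hs haF hX x
  have htop₁ : θ ^ n₁ * ((∏ _B ∈ blocks s ((X \ X₁) \ X), b) * ∏ Z ∈ components X, C * aF Z) ≤ (A ^ NX)⁻¹ := by
    rw [hXX, TorusPolymer.blocks_empty, prod_empty, one_mul, hPiCX C]
    have h1 : θ ^ n₁ * C ^ (components X).card ≤ 1 :=
      mul_le_one₀ (pow_le_one₀ hθ hθ1) (by positivity) (pow_le_one₀ hC hC1)
    calc θ ^ n₁ * (C ^ (components X).card * (A ^ NX)⁻¹) = θ ^ n₁ * C ^ (components X).card * (A ^ NX)⁻¹ := by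
          ring
      _ ≤ 1 * (A ^ NX)⁻¹ := mul_le_mul_of_nonneg_right h1 (by positivity)
      _ = (A ^ NX)⁻¹ := one_mul _
  have hin₁ : (∏ _B ∈ blocks s X₁, θ) * g₀ ≤ SS + (A ^ NX)⁻¹ := by
    rw [hθprod, hg₀def, ← sum_erase_add _ _ hXmem, mul_add, hSSdef, mul_sum]
    exact add_le_add (sum_le_sum fun Y hY => hY1 Y hY) htop₁
  have hin₃ : ((∏ _B ∈ blocks s X₁, (θ + Δ)) - ∏ _B ∈ blocks s X₁, θ) * g₀ ≤ 0 := by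
    calc ((∏ _B ∈ blocks s X₁, (θ + Δ)) - ∏ _B ∈ blocks s X₁, θ) * g₀
        ≤ (Δ * n₁ * (θ + Δ) ^ (n₁ - 1)) * g₀ := mul_le_mul_of_nonneg_right hdiff₃ hg₀0
      _ = 0 := by rw [hn₁0, Nat.cast_zero, mul_zero, zero_mul, zero_mul]
  set ρ₀ := ∑ Y ∈ polys s (X \ X₁),
      (((∏ _B ∈ blocks s ((X \ X₁) \ Y), (b' + ΔH)) - ∏ _B ∈ blocks s ((X \ X₁) \ Y), b') *
          ∏ Z ∈ components Y, C * aF Z +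
        (∏ _B ∈ blocks s ((X \ X₁) \ Y), b') *
          ((∏ Z ∈ components Y, (C * aF Z + CΔ * aF Z)) - ∏ Z ∈ components Y, C * aF Z)) with hρ₀def
  have htop₄ : θ ^ n₁ *
      ((((∏ _B ∈ blocks s ((X \ X₁) \ X), (b' + ΔH)) - ∏ _B ∈ blocks s ((X \ X₁) \ X), b') *
          ∏ Z ∈ components X, C * aF Z) +
        (∏ _B ∈ blocks s ((X \ X₁) \ X), b') *
          ((∏ Z ∈ components X, (C * aF Z + CΔ * aF Z)) - ∏ Z ∈ components X, C * aF Z)) ≤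
      CΔ * 2 ^ NX * (A ^ NX)⁻¹ := by
    have hPiCX' : ∏ Z ∈ components X, (C * aF Z + CΔ * aF Z) = (C + CΔ) ^ (components X).card * (A ^ NX)⁻¹ := by
      rw [← hPiCX (C + CΔ)]; exact prod_congr rfl fun Z _ => by ring
    rw [hXX, TorusPolymer.blocks_empty, prod_empty, prod_empty, sub_self, zero_mul, zero_add, one_mul, hPiCX',
      hPiCX C, ← sub_mul]
    set m := (components X).card with hm
    have hdiff : (C + CΔ) ^ m - C ^ m ≤ CΔ * m * (C + CΔ) ^ (m - 1) := by
      have := prod_const_add_sub_prod_const_le (components X) hC hCΔ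
      rwa [prod_const, prod_const] at this
    have hm' : (m : ℝ) ≤ 2 ^ NX := le_trans (by exact_mod_cast hmX) h2NX
    have hpow1 : (C + CΔ) ^ (m - 1) ≤ 1 := pow_le_one₀ (by positivity) (hCω.trans hω1)
    have hθn : θ ^ n₁ ≤ 1 := pow_le_one₀ hθ hθ1
    have h1 : (C + CΔ) ^ m - C ^ m ≤ CΔ * 2 ^ NX := by
      calc (C + CΔ) ^ m - C ^ m ≤ CΔ * m * (C + CΔ) ^ (m - 1) := hdiff
        _ ≤ CΔ * 2 ^ NX * 1 := by gcongr
        _ = CΔ * 2 ^ NX := mul_one _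
    have h0 : 0 ≤ ((C + CΔ) ^ m - C ^ m) * (A ^ NX)⁻¹ :=
      mul_nonneg (sub_nonneg.2 (pow_le_pow_left₀ hC (by linarith) _)) (by positivity)
    calc θ ^ n₁ * (((C + CΔ) ^ m - C ^ m) * (A ^ NX)⁻¹) ≤ 1 * (((C + CΔ) ^ m - C ^ m) * (A ^ NX)⁻¹) :=
          mul_le_mul_of_nonneg_right hθn h0
      _ ≤ 1 * ((CΔ * 2 ^ NX) * (A ^ NX)⁻¹) := by
          refine mul_le_mul_of_nonneg_left (mul_le_mul_of_nonneg_right h1 (by positivity)) zero_le_one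
      _ = CΔ * 2 ^ NX * (A ^ NX)⁻¹ := by ring
  have hin₄ : (∏ _B ∈ blocks s X₁, θ) * ρ₀ ≤ (ΔH + CΔ) * 2 ^ NX * SS + CΔ * 2 ^ NX * (A ^ NX)⁻¹ := by
    rw [hθprod, hρ₀def, ← sum_erase_add _ _ hXmem, mul_add]
    refine add_le_add ?_ htop₄
    rw [mul_sum]
    calc ∑ Y ∈ (polys s (X \ X₁)).erase X, θ ^ n₁ *
          ((((∏ _B ∈ blocks s ((X \ X₁) \ Y), (b' + ΔH)) - ∏ _B ∈ blocks s ((X \ X₁) \ Y), b') *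
              ∏ Z ∈ components Y, C * aF Z) +
            (∏ _B ∈ blocks s ((X \ X₁) \ Y), b') *
              ((∏ Z ∈ components Y, (C * aF Z + CΔ * aF Z)) - ∏ Z ∈ components Y, C * aF Z))
        ≤ ∑ Y ∈ (polys s (X \ X₁)).erase X, (ΔH * 2 ^ NX * S Y + CΔ * 2 ^ NX * S Y) := by
          refine sum_le_sum fun Y hY => ?_
          rw [mul_add]
          exact add_le_add (hY4a Y hY) (hY4b Y hY)
      _ = (ΔH + CΔ) * 2 ^ NX * SS := by rw [hSSdef, mul_sum]; exact sum_congr rfl fun Y _ => by ring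
  have haF0 : ∀ Z, 0 ≤ aF Z := fun Z => by rw [haF Z]; positivity
  have hρ₀0 : 0 ≤ (∏ _B ∈ blocks s X₁, θ) * ρ₀ := by
    rw [hρ₀def]
    refine mul_nonneg (prod_nonneg fun _ _ => hθ) (sum_nonneg fun Y _ => ?_)
    have e1 : ∏ _B ∈ blocks s ((X \ X₁) \ Y), b' ≤ ∏ _B ∈ blocks s ((X \ X₁) \ Y), (b' + ΔH) :=
      prod_le_prod (fun _ _ => hb') (fun _ _ => by linarith)
    have e2 : ∏ Z ∈ components Y, C * aF Z ≤ ∏ Z ∈ components Y, (C * aF Z + CΔ * aF Z) :=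
      prod_le_prod (fun Z _ => mul_nonneg hC (haF0 Z))
        (fun Z _ => le_add_of_nonneg_right (mul_nonneg hCΔ (haF0 Z)))
    have e3 : 0 ≤ ∏ Z ∈ components Y, C * aF Z := prod_nonneg fun Z _ => mul_nonneg hC (haF0 Z)
    have e4 : 0 ≤ ∏ _B ∈ blocks s ((X \ X₁) \ Y), b' := prod_nonneg fun _ _ => hb'
    exact add_nonneg (mul_nonneg (sub_nonneg.2 e1) e3) (mul_nonneg e4 (sub_nonneg.2 e2))
  have hθg0 : 0 ≤ (∏ _B ∈ blocks s X₁, θ) * g₀ := mul_nonneg (prod_nonneg fun _ _ => hθ) hg₀0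
  -- assemble
  have h2NX1 : (1 : ℝ) ≤ 2 ^ NX := one_le_pow₀ (by norm_num)
  have hA𝒫'0 : 0 ≤ A𝒫' ^ NX := by positivity
  have hrhs : ∑ Y ∈ (polys s (X \ X₁)).erase X, (2 * κ * A𝒫') ^ NX * (κ ^ cU * ((3 * Δ + ΔH + CΔ) * (ω * A ^ 4))) *
        (A ^ (2 * (blocks s (X \ Y)).card + (blocks s Y).card + (components Y).card))⁻¹ =
      2 ^ NX * κ ^ NX * A𝒫' ^ NX * κ ^ cU * (3 * Δ + ΔH + CΔ) * SS := by
    rw [hSSdef, mul_sum]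
    refine sum_congr rfl fun Y _ => ?_
    rw [hSdef, mul_pow, mul_pow]
    ring
  have hrhs₂ : (2 * κ * A𝒫') ^ NX * (κ ^ cU * (2 * Δ + CΔ)) * (A ^ NX)⁻¹ =
      2 ^ NX * κ ^ NX * A𝒫' ^ NX * κ ^ cU * (2 * Δ + CΔ) * (A ^ NX)⁻¹ := by rw [mul_pow, mul_pow]; ring
  rw [hrhs, hrhs₂]
  have hI0 : 0 ≤ (A ^ NX)⁻¹ := by positivity
  have hSSI0 : 0 ≤ SS + (A ^ NX)⁻¹ := add_nonneg hSS0 hI0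
  calc _ ≤ (Δ * κ ^ cU) * κ ^ NX * ((SS + (A ^ NX)⁻¹) * A𝒫' ^ NX) +
        κ ^ cU * (Δ * κ ^ NX) * ((SS + (A ^ NX)⁻¹) * A𝒫' ^ NX) +
        κ ^ cU * κ ^ NX * (0 * A𝒫' ^ NX) +
        κ ^ cU * κ ^ NX * (((ΔH + CΔ) * 2 ^ NX * SS + CΔ * 2 ^ NX * (A ^ NX)⁻¹) * A𝒫' ^ NX) := by
        refine add_le_add (add_le_add (add_le_add ?_ ?_) ?_) ?_
        · rw [show (∏ _B ∈ blocks s X₁, θ) * (g₀ * A𝒫 ^ numBlocks s (X \ X₁)) =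
              ((∏ _B ∈ blocks s X₁, θ) * g₀) * A𝒫 ^ numBlocks s (X \ X₁) by ring]
          exact mul_le_mul (mul_le_mul hdiff₁ ha₂ ha₂0 (by positivity))
            (mul_le_mul hin₁ hP𝒫 (by positivity) hSSI0) (mul_nonneg hθg0 (by positivity)) (by positivity)
        · rw [show (∏ _B ∈ blocks s X₁, θ) * (g₀ * A𝒫 ^ numBlocks s (X \ X₁)) =
              ((∏ _B ∈ blocks s X₁, θ) * g₀) * A𝒫 ^ numBlocks s (X \ X₁) by ring]
          exact mul_le_mul (mul_le_mul ha₁ hdiff₂ hdiff₂0 (by positivity))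
            (mul_le_mul hin₁ hP𝒫 (by positivity) hSSI0) (mul_nonneg hθg0 (by positivity)) (by positivity)
        · rw [show ((∏ _B ∈ blocks s X₁, (θ + Δ)) - ∏ _B ∈ blocks s X₁, θ) * (g₀ * A𝒫 ^ numBlocks s (X \ X₁)) =
              (((∏ _B ∈ blocks s X₁, (θ + Δ)) - ∏ _B ∈ blocks s X₁, θ) * g₀) * A𝒫 ^ numBlocks s (X \ X₁) by ring]
          exact mul_le_mul (mul_le_mul ha₁ ha₂ ha₂0 (by positivity))
            (mul_le_mul hin₃ hP𝒫 (by positivity) le_rfl)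
            (mul_nonneg (mul_nonneg hdiff₃0 hg₀0) (by positivity)) (by positivity)
        · rw [show (∏ _B ∈ blocks s X₁, θ) * (ρ₀ * A𝒫 ^ numBlocks s (X \ X₁)) =
              ((∏ _B ∈ blocks s X₁, θ) * ρ₀) * A𝒫 ^ numBlocks s (X \ X₁) by ring]
          exact mul_le_mul (mul_le_mul ha₁ ha₂ ha₂0 (by positivity))
            (mul_le_mul hin₄ hP𝒫 (by positivity) (by positivity))
            (mul_nonneg hρ₀0 (by positivity)) (by positivity)
    _ = κ ^ cU * κ ^ NX * A𝒫' ^ NX * ((Δ + Δ + 2 ^ NX * (ΔH + CΔ)) * SS +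
          (Δ + Δ + 2 ^ NX * CΔ) * (A ^ NX)⁻¹) := by ring
    _ ≤ κ ^ cU * κ ^ NX * A𝒫' ^ NX * ((2 ^ NX * (3 * Δ + ΔH + CΔ)) * SS +
          (2 ^ NX * (2 * Δ + CΔ)) * (A ^ NX)⁻¹) := by
        have h1 : Δ ≤ 2 ^ NX * Δ := by
          have := mul_le_mul_of_nonneg_right h2NX1 hΔ; linarith only [this]
        have h2 : Δ + Δ + 2 ^ NX * (ΔH + CΔ) ≤ 2 ^ NX * (3 * Δ + ΔH + CΔ) := by linarith only [h1, hΔ]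
        have h3 : Δ + Δ + 2 ^ NX * CΔ ≤ 2 ^ NX * (2 * Δ + CΔ) := by linarith only [h1, hΔ]
        exact mul_le_mul_of_nonneg_left (add_le_add (mul_le_mul_of_nonneg_right h2 hSS0)
          (mul_le_mul_of_nonneg_right h3 hI0)) (by positivity)
    _ = 2 ^ NX * κ ^ NX * A𝒫' ^ NX * κ ^ cU * (3 * Δ + ΔH + CΔ) * SS +
        2 ^ NX * κ ^ NX * A𝒫' ^ NX * κ ^ cU * (2 * Δ + CΔ) * (A ^ NX)⁻¹ := by ring

end Literature.MathematicalPhysics.StatisticalMechanics.TorusPolymer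

end
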